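import Summits.QuantumFields.QCD.Theorems.WilsonMobilityGapChiralMobilityGapSketchDefs
import Literature.MathematicalPhysics.QuantumFieldTheory.QCDPhaseQuenchedPositivity

/-!
# Crux `ChiralMobilityGap` (stmt-QuantumFields-17497) — line `Ideator3Sketch` (card
# `sign-threshold-anchor`): the generalised sign ANCHOR and the EXPLICIT anchored witness `anchorReg`

Definitions of the registered skeleton `Cruxes/ChiralMobilityGap/Lines/Ideator3Sketch.lean` (lead
prover-line-stmt-QuantumFields-17497-c1-0), kept out of proof files, with everything they carry BY
CONSTRUCTION proved here:

* `pionWt Nf L t f U` — the pion weight `Σ_{a,i,b,j}|G_f(U)((0,a,i),(L e₀,b,j))|²` on the torus of side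
  `2L+1` (verbatim shape of `ChiralMobilityGapSketch.pionWeight`);
* `GoodFloor Nf β L u` — the GENERALISED SIGN CERTIFICATE: every bare tuple strictly above `u` is
  sign-coherent at side `2L+1`, for the bare determinant (clause (iv) of the crux in product form
  `½∫|det| ≤ ‖∫det‖`) and for the pion-weighted determinant of every flavour; good floors `≥ -1` form an
  up-set (`goodFloor_mono`) containing `0` (`goodFloor_zero`, Seiler positivity) whose infimum
  `anchorThr Nf β L ∈ [-1, 0]` is ATTAINED WITHOUT CONTINUITY (`goodFloor_anchorThr`: the certificate at
  `u` speaks only of tuples strictly above `u`) and minimal (`not_goodFloor_of_lt_anchorThr`);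
* `anchorReg Nf` — the explicit regularisation `a_k = 1/(k+2)`, `β_k = afBeta N_f 1 a_k`,
  `Z_m(k) = (log a_k⁻²)^{γ₀/(2β₀)}`, `L_k = (k+2)⌈log(k+2)⌉²`, `m_crit(k) := anchorThr N_f β_k L_k`;
  it has leading-log mass scaling and two-loop asymptotic scaling (`anchorReg_hasMassScaling`,
  `anchorReg_hasAsymptoticScaling`), and carries clause (i) (`anchorReg_clauseI`), clause (iv) at EVERY
  `k` for EVERY split positive tuple (`anchorReg_sign`) and the `N_f = 3` pion-weight sign input of the
  landed pin lemma (`anchorReg_pionWeightSignCoherent`, constant `1/2`) — all by order logic.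

What is NOT here (the registered stubs of the line): (ii) UPPER, (iii) LOWER and the vanishing chiral
rate along `anchorReg` (the open content, containing the kernel-necessary core `LightMomentFree`), and
the super-log volume growth of the explicit data (analysis stub).
-/

noncomputable section

namespace Summit.QuantumFields.QCD.Theorems.ChiralMobilityGapAnchor

open scoped BigOperators Topology
open MeasureTheory Filter Set
open Literature.MathematicalPhysics.QuantumFieldTheory Literature.MathematicalPhysics.QuantumLattice
  Literature.Probability.LatticeModels
open Summit.QuantumFields.QCD.Theorems.MobilityGapNegative (bare fm ClauseI Upper Lower Sign Clauses
  det_diracMatrix_eq_norm_of_pos)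
open Summit.QuantumFields.QCD.Theorems.ChiralMobilityGapSketch (pionWeight PionWeightSignCoherent)

variable {Nf : ℕ}

/-! ### §1 The generalised sign certificate and its threshold -/

/-- The pion weight of flavour `f` at bare tuple `t` on the torus of side `2L+1`, separation `L e₀`:
`X(U) = Σ_{a,i,b,j} |G_f(U)((0,a,i),(L e₀,b,j))|²` (verbatim shape of `pionWeight`). -/
def pionWt (Nf : ℕ) (L : ℕ) (t : Fin Nf → ℝ) (f : Fin Nf) (U : GaugeConfig 4 (2 * L + 1) SU3) : ℝ :=
  ∑ a : Fin 3, ∑ i : Fin 4, ∑ b : Fin 3, ∑ j : Fin 4,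
    ‖(diracMatrix U t)⁻¹ (quarkEquiv (f, (Torus.proj (2 * L + 1) 0, a, i)))
        (quarkEquiv (f, (Torus.proj (2 * L + 1) (Pi.single 0 (L : ℤ)), b, j)))‖ ^ (2 : ℕ)

/-- The pion weight is non-negative. -/
theorem pionWt_nonneg (Nf : ℕ) (L : ℕ) (t : Fin Nf → ℝ) (f : Fin Nf) (U : GaugeConfig 4 (2 * L + 1) SU3) :
    0 ≤ pionWt Nf L t f U := by
  unfold pionWt; positivity

/-- `GoodFloor Nf β L u`: EVERY bare tuple strictly above the floor `u` is sign-coherent on the torus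
of side `2L+1` at coupling `β` — for the bare determinant (`½ ∫|det| ≤ ‖∫det‖`, clause (iv) in
product form) AND for the pion-weighted determinant of every flavour at separation `L`
(`½ ∫|det| X ≤ ‖∫ det·X‖`). -/
def GoodFloor (Nf : ℕ) (β : ℝ) (L : ℕ) (u : ℝ) : Prop :=
  ∀ t : Fin Nf → ℝ, (∀ f, u < t f) →
    (1 / 2 : ℝ) * (∫ U : GaugeConfig 4 (2 * L + 1) SU3, ‖(diracMatrix U t).det‖
        ∂(wilsonMeasure (fundamentalRep (Fin 3)) β)) ≤
      ‖∫ U : GaugeConfig 4 (2 * L + 1) SU3, (diracMatrix U t).det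
        ∂(wilsonMeasure (fundamentalRep (Fin 3)) β)‖ ∧
    ∀ f : Fin Nf,
      (1 / 2 : ℝ) * (∫ U : GaugeConfig 4 (2 * L + 1) SU3, ‖(diracMatrix U t).det‖ * pionWt Nf L t f U
          ∂(wilsonMeasure (fundamentalRep (Fin 3)) β)) ≤
        ‖∫ U : GaugeConfig 4 (2 * L + 1) SU3, (diracMatrix U t).det * ((pionWt Nf L t f U : ℝ) : ℂ)
          ∂(wilsonMeasure (fundamentalRep (Fin 3)) β)‖

/-- Good floors form an up-set. -/
theorem goodFloor_mono {β : ℝ} {L : ℕ} {u u' : ℝ} (h : u ≤ u') (hu : GoodFloor Nf β L u) :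
    GoodFloor Nf β L u' :=
  fun t ht => hu t fun f => h.trans_lt (ht f)

/-- **`0` is a good floor** (Seiler positivity): at an all-positive bare tuple the Wilson determinant
is the non-negative real `|det|` configuration-wise, so both signed integrals equal their
phase-quenched counterparts. -/
theorem goodFloor_zero (Nf : ℕ) (β : ℝ) (L : ℕ) : GoodFloor Nf β L 0 := by
  intro t ht
  have hdet : ∀ U : GaugeConfig 4 (2 * L + 1) SU3,
      (diracMatrix U t).det = ((‖(diracMatrix U t).det‖ : ℝ) : ℂ) := fun U =>
    det_diracMatrix_eq_norm_of_pos U t ht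
  refine ⟨?_, fun f => ?_⟩
  · have hI : ∫ U : GaugeConfig 4 (2 * L + 1) SU3, (diracMatrix U t).det
          ∂(wilsonMeasure (fundamentalRep (Fin 3)) β) =
        ((∫ U : GaugeConfig 4 (2 * L + 1) SU3, ‖(diracMatrix U t).det‖
          ∂(wilsonMeasure (fundamentalRep (Fin 3)) β) : ℝ) : ℂ) := by
      rw [← integral_complex_ofReal]
      exact integral_congr_ae (Eventually.of_forall fun U => hdet U)
    have hZ : 0 ≤ ∫ U : GaugeConfig 4 (2 * L + 1) SU3, ‖(diracMatrix U t).det‖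
        ∂(wilsonMeasure (fundamentalRep (Fin 3)) β) := integral_nonneg fun _ => norm_nonneg _
    rw [hI, Complex.norm_real, Real.norm_eq_abs, abs_of_nonneg hZ]
    linarith
  · have hI : ∫ U : GaugeConfig 4 (2 * L + 1) SU3, (diracMatrix U t).det * ((pionWt Nf L t f U : ℝ) : ℂ)
          ∂(wilsonMeasure (fundamentalRep (Fin 3)) β) =
        ((∫ U : GaugeConfig 4 (2 * L + 1) SU3, ‖(diracMatrix U t).det‖ * pionWt Nf L t f U
          ∂(wilsonMeasure (fundamentalRep (Fin 3)) β) : ℝ) : ℂ) := by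
      rw [← integral_complex_ofReal]
      refine integral_congr_ae (Eventually.of_forall fun U => ?_)
      show (diracMatrix U t).det * ((pionWt Nf L t f U : ℝ) : ℂ) =
        (((‖(diracMatrix U t).det‖ * pionWt Nf L t f U : ℝ)) : ℂ)
      rw [Complex.ofReal_mul, ← hdet U]
    have hZ : 0 ≤ ∫ U : GaugeConfig 4 (2 * L + 1) SU3, ‖(diracMatrix U t).det‖ * pionWt Nf L t f U
        ∂(wilsonMeasure (fundamentalRep (Fin 3)) β) :=
      integral_nonneg fun U => mul_nonneg (norm_nonneg _) (pionWt_nonneg Nf L t f U)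
    rw [hI, Complex.norm_real, Real.norm_eq_abs, abs_of_nonneg hZ]
    linarith

/-- Good floors on the physical branch `u ≥ -1`. -/
def floorSet (Nf : ℕ) (β : ℝ) (L : ℕ) : Set ℝ := {u | -1 ≤ u ∧ GoodFloor Nf β L u}

/-- **THE ANCHOR** `anchorThr := inf {u ≥ -1 | u is a good floor}` — the joint parity onset of the bare
and pion-weighted determinant signs on the torus of side `2L+1`, read downwards in the bare mass. -/
def anchorThr (Nf : ℕ) (β : ℝ) (L : ℕ) : ℝ := sInf (floorSet Nf β L)

/-- `0 ∈ floorSet`. -/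
theorem zero_mem_floorSet (Nf : ℕ) (β : ℝ) (L : ℕ) : (0 : ℝ) ∈ floorSet Nf β L :=
  ⟨by norm_num, goodFloor_zero Nf β L⟩

/-- The floor set is bounded below by `-1`. -/
theorem floorSet_bddBelow (Nf : ℕ) (β : ℝ) (L : ℕ) : BddBelow (floorSet Nf β L) :=
  ⟨-1, fun _ hu => hu.1⟩

/-- `-1 ≤ anchorThr`. -/
theorem neg_one_le_anchorThr (Nf : ℕ) (β : ℝ) (L : ℕ) : -1 ≤ anchorThr Nf β L :=
  le_csInf ⟨0, zero_mem_floorSet Nf β L⟩ fun _ hu => hu.1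

/-- `anchorThr ≤ 0`. -/
theorem anchorThr_le_zero (Nf : ℕ) (β : ℝ) (L : ℕ) : anchorThr Nf β L ≤ 0 :=
  csInf_le (floorSet_bddBelow Nf β L) (zero_mem_floorSet Nf β L)

/-- **ATTAINMENT WITHOUT CONTINUITY.** The anchor is itself a good floor: a tuple all of whose
components lie STRICTLY above `anchorThr` lies strictly above some good floor. -/
theorem goodFloor_anchorThr (Nf : ℕ) (β : ℝ) (L : ℕ) : GoodFloor Nf β L (anchorThr Nf β L) := by
  classical
  intro t ht
  rcases isEmpty_or_nonempty (Fin Nf) with hE | hN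
  · exact goodFloor_zero Nf β L t fun f => (IsEmpty.false f).elim
  · obtain ⟨f₀, hf₀⟩ := Finite.exists_min t
    obtain ⟨u, hu, hut⟩ := exists_lt_of_csInf_lt ⟨0, zero_mem_floorSet Nf β L⟩ (ht f₀)
    exact hu.2 t fun f => hut.trans_le (hf₀ f)

/-- **Minimality** (the free spectral fact just below the anchor): every floor in `[-1, anchorThr)`
has a tuple above it violating one of the two coherence inequalities. -/
theorem not_goodFloor_of_lt_anchorThr (Nf : ℕ) (β : ℝ) (L : ℕ) {x : ℝ} (hx1 : -1 ≤ x)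
    (hx : x < anchorThr Nf β L) : ¬ GoodFloor Nf β L x := fun h =>
  absurd (csInf_le (floorSet_bddBelow Nf β L) ⟨hx1, h⟩) (not_le.2 hx)

/-! ### §2 The explicit anchored regularisation -/

/-- Lattice spacings `a_k = 1/(k+2)`. -/
def anchorA (k : ℕ) : ℝ := 1 / ((k : ℝ) + 2)

/-- Torus half-sides `L_k = (k+2)·⌈log(k+2)⌉²` (physical side `a_k L_k = ⌈log(k+2)⌉²`). -/
def anchorSide (k : ℕ) : ℕ := (k + 2) * ⌈Real.log ((k : ℝ) + 2)⌉₊ ^ 2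

/-- The canonical mass renormalisation `Z_m(k) = (log a_k⁻²)^{γ₀/(2β₀)}`. -/
def anchorZm (Nf : ℕ) (k : ℕ) : ℝ := Real.log (1 / anchorA k ^ 2) ^ massExponent Nf

/-- `0 < a_k`. -/
theorem anchorA_pos (k : ℕ) : 0 < anchorA k := by
  unfold anchorA; positivity

/-- `a_k → 0`. -/
theorem tendsto_anchorA : Tendsto anchorA atTop (𝓝 0) := by
  have h : Tendsto (fun k : ℕ => (k : ℝ) + 2) atTop atTop :=
    tendsto_natCast_atTop_atTop.atTop_add tendsto_const_nhds
  rw [show anchorA = fun k : ℕ => ((k : ℝ) + 2)⁻¹ from funext fun k => one_div _]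
  exact h.inv_tendsto_atTop

/-- `1 < a_k⁻²` (so its logarithm is positive). -/
theorem one_lt_inv_anchorA_sq (k : ℕ) : 1 < 1 / anchorA k ^ 2 := by
  have hk : (2 : ℝ) ≤ (k : ℝ) + 2 := by
    have : (0 : ℝ) ≤ k := Nat.cast_nonneg k
    linarith
  have h1 : (1 : ℝ) < ((k : ℝ) + 2) ^ 2 := by nlinarith
  simpa [anchorA] using h1

/-- `0 < Z_m(k)`. -/
theorem anchorZm_pos (Nf : ℕ) (k : ℕ) : 0 < anchorZm Nf k :=
  Real.rpow_pos_of_pos (Real.log_pos (one_lt_inv_anchorA_sq k)) _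

/-- The physical side is `a_k L_k = ⌈log(k+2)⌉²`. -/
theorem anchorA_mul_side (k : ℕ) : anchorA k * (anchorSide k : ℝ) = (⌈Real.log ((k : ℝ) + 2)⌉₊ : ℝ) ^ 2 := by
  have hk : (k : ℝ) + 2 ≠ 0 := by positivity
  unfold anchorA anchorSide
  push_cast
  field_simp

/-- `a_k L_k → ∞`. -/
theorem tendsto_anchorA_mul_side : Tendsto (fun k => anchorA k * (anchorSide k : ℝ)) atTop atTop := by
  have h1 : Tendsto (fun k : ℕ => Real.log ((k : ℝ) + 2)) atTop atTop :=
    Real.tendsto_log_atTop.comp (tendsto_natCast_atTop_atTop.atTop_add tendsto_const_nhds)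
  have h2 : Tendsto (fun k : ℕ => (⌈Real.log ((k : ℝ) + 2)⌉₊ : ℝ)) atTop atTop :=
    tendsto_natCast_atTop_atTop.comp (tendsto_nat_ceil_atTop.comp h1)
  have h3 : Tendsto (fun k : ℕ => (⌈Real.log ((k : ℝ) + 2)⌉₊ : ℝ) ^ 2) atTop atTop :=
    (tendsto_pow_atTop two_ne_zero).comp h2
  refine h3.congr fun k => ?_
  rw [anchorA_mul_side]

variable (Nf) in
/-- **The explicit sign-anchored regularisation** `anchorReg N_f`: canonical spacings, two-loop
couplings (`Λ = 1`), canonical `Z_m`, super-logarithmic volumes, and the critical bare mass DEFINED as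
the generalised sign threshold `m_crit(k) := anchorThr N_f β_k L_k`. -/
def anchorReg : QCDRegularisation Nf where
  a := anchorA
  a_pos := anchorA_pos
  tendsto_a := tendsto_anchorA
  β := fun k => afBeta Nf 1 (anchorA k)
  L := anchorSide
  tendsto_L := tendsto_anchorA_mul_side
  mcrit := fun k => anchorThr Nf (afBeta Nf 1 (anchorA k)) (anchorSide k)
  Zm := anchorZm Nf
  Zm_pos := anchorZm_pos Nf

/-- Unfolding `a`. -/
@[simp] theorem anchorReg_a (k : ℕ) : (anchorReg Nf).a k = anchorA k := rfl
/-- Unfolding `β`. -/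
@[simp] theorem anchorReg_β (k : ℕ) : (anchorReg Nf).β k = afBeta Nf 1 (anchorA k) := rfl
/-- Unfolding `L`. -/
@[simp] theorem anchorReg_L (k : ℕ) : (anchorReg Nf).L k = anchorSide k := rfl
/-- Unfolding `Z_m`. -/
@[simp] theorem anchorReg_Zm (k : ℕ) : (anchorReg Nf).Zm k = anchorZm Nf k := rfl
/-- Unfolding `m_crit`: the anchor. -/
@[simp] theorem anchorReg_mcrit (k : ℕ) :
    (anchorReg Nf).mcrit k = anchorThr Nf (afBeta Nf 1 (anchorA k)) (anchorSide k) := rfl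

/-! ### §3 What the anchored witness carries BY CONSTRUCTION -/

/-- Leading-log mass scaling (`c = 1`: `Z_m` IS the canonical profile). -/
theorem anchorReg_hasMassScaling : (anchorReg Nf).HasMassScaling := by
  refine ⟨1, one_pos, tendsto_const_nhds.congr fun k => ?_⟩
  change (1 : ℝ) = anchorZm Nf k / anchorZm Nf k
  rw [div_self (anchorZm_pos Nf k).ne']

/-- Two-loop asymptotic scaling (`Λ = 1`: `β_k` IS the profile). -/
theorem anchorReg_hasAsymptoticScaling : ((anchorReg Nf).scheme 0 0 0).HasAsymptoticScaling :=
  ⟨1, one_pos, by simp [QCDRegularisation.scheme, anchorReg]⟩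

/-- The increments `a_k m_f / Z_m(k)` are positive for positive tuples. -/
theorem incr_pos {m : Fin Nf → ℝ} (hm : ∀ f, 0 < m f) (k : ℕ) (f : Fin Nf) :
    0 < (anchorReg Nf).a k * m f / (anchorReg Nf).Zm k :=
  div_pos (mul_pos ((anchorReg Nf).a_pos k) (hm f)) ((anchorReg Nf).Zm_pos k)

/-- Every realised bare tuple of a positive mass tuple lies strictly above the anchor. -/
theorem anchorThr_lt_bare {m : Fin Nf → ℝ} (hm : ∀ f, 0 < m f) (k : ℕ) (f : Fin Nf) :
    anchorThr Nf ((anchorReg Nf).β k) ((anchorReg Nf).L k) < bare (anchorReg Nf) m k f := by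
  have := incr_pos hm k f
  show anchorThr Nf (afBeta Nf 1 (anchorA k)) (anchorSide k) <
    anchorThr Nf (afBeta Nf 1 (anchorA k)) (anchorSide k) + (anchorReg Nf).a k * m f / (anchorReg Nf).Zm k
  linarith

/-- **Clause (i) for free**, at every `k`. -/
theorem anchorReg_clauseI (m : Fin Nf → ℝ) (hm : ∀ f, 0 < m f) : ClauseI (anchorReg Nf) m := by
  intro f
  refine Eventually.of_forall fun k => ?_
  have h1 := anchorThr_lt_bare hm k f
  have h2 := neg_one_le_anchorThr Nf ((anchorReg Nf).β k) ((anchorReg Nf).L k)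
  exact lt_of_le_of_lt h2 h1

/-- **Clause (iv) for free**, at every `k`, for every split tuple. -/
theorem anchorReg_sign (m : Fin Nf → ℝ) (hm : ∀ f, 0 < m f) : Sign (anchorReg Nf) m := by
  refine Eventually.of_forall fun k => ?_
  have hgood := (goodFloor_anchorThr Nf ((anchorReg Nf).β k) ((anchorReg Nf).L k)
    (bare (anchorReg Nf) m k) (anchorThr_lt_bare hm k)).1
  have hZ := integral_norm_det_diracMatrix_pos_all (S := 2 * (anchorReg Nf).L k + 1)
    ((anchorReg Nf).β k) (bare (anchorReg Nf) m k)
  rw [le_div_iff₀ hZ]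
  exact hgood

/-- **The `N_f = 3` sign input for free**: sign coherence of the pion-weighted determinant at the
scheme's own side, with `c = 1/2`, at every `k` and every `t > 0`. -/
theorem anchorReg_pionWeightSignCoherent : PionWeightSignCoherent (anchorReg 3) := by
  intro t ht
  refine ⟨1 / 2, by norm_num, Eventually.of_forall fun k => ?_⟩
  have hm : ∀ f : Fin 3, 0 < (fun _ : Fin 3 => t) f := fun _ => ht
  exact (goodFloor_anchorThr 3 ((anchorReg 3).β k) ((anchorReg 3).L k)
    (bare (anchorReg 3) (fun _ => t) k) (anchorThr_lt_bare hm k)).2 0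

end Summit.QuantumFields.QCD.Theorems.ChiralMobilityGapAnchor

end
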